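import Mathlib.NumberTheory.ArithmeticFunction.Moebius
import Mathlib.Data.Nat.Squarefree
import Mathlib.Algebra.Order.BigOperators.Ring.Finset
import HarnessLib

/-!
# Friedlander–Iwaniec, *The polynomial `X² + Y⁴` captures its primes*, §24: the separation divisor `𝔡(ℓ)` and the factorisation `ℓ = 𝔡 m n` ((24.1)–(24.8))

Family `parity`, statement parity.S17 (`setOf_prime_sq_add_pow_four_infinite`). Source: J. Friedlander,
H. Iwaniec, Ann. of Math. (2) 148 (1998), 945–1040 [FriedlanderIwaniecAnnals1998], §24 "Combinatorial
identities for sums of arithmetic functions", (24.1)–(24.8) (arXiv math/9811185, pp. 81–82). Part of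
the independent unit §§19–26 of the source (map in `FriedlanderIwaniecPrimesDirichletSymbol`); §24 is
the combinatorial device by which §25 reduces Proposition 17.2 to the bilinear forms of §23 and to
Theorem 2^ψ. Everything here is PROVED (elementary combinatorics of the prime factorisation); the
definitions are `primeIdx`, `nthPrimeDesc`, `IsSepIdx`/`IsPlusIdx`/`IsMinusIdx`, `sepDivisor` (`𝔡`),
`plusPart` (`m`), `minusPart` (`n`), `shiftPrime`, `idxBlock`; no named facts. The sequel (same
prefix, `…SeparationIdentity`) proves the intrinsic description `(𝔡⁺)`, `(𝔡⁻)` of `m`, `n`, the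
uniqueness of the factorisation, Lemma 24.1 and Proposition 24.2.

## The construction (source, p. 81)

"Fix `r ≥ 2`. For every squarefree number, say `ℓ = p₁ p₂ …`, with `p₁ > p₂ > …`, we define the
divisor `𝔡 = 𝔡(ℓ)` by setting (24.2) `𝔡 = p₁ … p_r p_{2r} p_{3r} …`. Here and throughout this
section the product of primes terminates when it runs out of primes of `ℓ` … Note that (24.3)
`𝔡 ≤ ℓ^{1/r} p₁^{r-1}`. We shall call `𝔡 = 𝔡(ℓ)` the "separation" divisor of `ℓ` … Then we define the
divisors `m = m(ℓ)`, `n = n(ℓ)` by setting (24.4) `m = (p_{r+1} … p_{2r-1})(p_{3r+1} … p_{4r-1}) …`,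
(24.5) `n = (p_{2r+1} … p_{3r-1})(p_{4r+1} … p_{5r-1}) …`. Note that (24.6) `n ≤ m ≤ 𝔡 n` … Hence we
obtain the factorization (24.7) `ℓ = 𝔡 m n` … By (24.6) and (24.7) it follows that (24.8)
`m, n ≤ √ℓ`."

## Contents

* `primeIdx ℓ p = #{q ∣ ℓ prime : q > p} + 1` — the index `j` of `p = pⱼ` in the decreasing
  enumeration (no lists or sorting: everything is phrased through this rank function);
  `primeIdx_lt_of_lt`, `primeIdx_injOn`, `image_primeIdx` (`= [1, ω(ℓ)]`), `exists_primeIdx_eq`,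
  `lt_iff_primeIdx_lt`, and the inverse enumeration `nthPrimeDesc ℓ j = pⱼ` (`nthPrimeDesc_spec`).
* `IsSepIdx r j` (`j ≤ r ∨ r ∣ j`), `IsPlusIdx r j` (`j > r`, `r ∤ j`, block `⌊(j-1)/r⌋` odd),
  `IsMinusIdx r j` (block even); they partition the indices (`isSepIdx_or`, the three `not_…`
  lemmas); `sepDivisor r ℓ = 𝔡(ℓ)` (24.2), `plusPart r ℓ = m(ℓ)` (24.4), `minusPart r ℓ = n(ℓ)` (24.5)
  as products of the prime factors in each class; **(24.7)** `sepDivisor_mul_plusPart_mul_minusPart`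
  (`ℓ = 𝔡 m n` for squarefree `ℓ`).
* **(24.6)** `minusPart_le_plusPart` (`n ≤ m`) and `plusPart_le_sepDivisor_mul_minusPart`
  (`m ≤ 𝔡 n`): shifting each prime `r` places up the enumeration (`shiftPrime`, `shiftPrime_spec`,
  `shiftPrime_injOn`, `isPlusIdx_sub_of_isMinusIdx`, `isSepIdx_or_isMinusIdx_sub_of_isPlusIdx`) is
  an injection onto larger primes of the target class; **(24.8)** `plusPart_sq_le`, `minusPart_sq_le`
  (`m² ≤ ℓ`, `n² ≤ ℓ`).
* **(24.3)** `prod_core_pow_le` (`(p_r p_{2r} p_{3r} ⋯)^r ≤ ℓ`: `p_{kr}^r` is at most the product of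
  the `r` primes of the block `idxBlock` ending at index `kr`, and the blocks are disjoint) and
  `sepDivisor_pow_le`: `𝔡(ℓ)^r ≤ P^{r(r-1)} ℓ` when all prime factors of `ℓ` are `≤ P` — the integer
  form of `𝔡 ≤ ℓ^{1/r} p₁^{r-1}`, which with `p₁ ≤ z = x^{1/r²}`, `ℓ ≤ x` gives (24.10) `𝔡 ≤ x^{2/r}`.

## References

* J. Friedlander, H. Iwaniec, Ann. of Math. (2) 148 (1998), 945–1040, §24, (24.1)–(24.8).
  [FriedlanderIwaniecAnnals1998]

## Mathlib

`Nat.primeFactors`, `Nat.prod_primeFactors_of_squarefree`, `Finset.prod_union`, `Finset.prod_biUnion`,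
`Finset.prod_image`, `Finset.pow_card_le_prod`, `Finset.prod_dvd_prod_of_subset`,
`Finset.card_image_of_injOn`, `Finset.eq_of_subset_of_card_le`, `Nat.sub_mul_div`, `Nat.odd_sub'`,
`Nat.even_sub'`.
-/

open Finset

namespace Literature.NumberTheory.Sieve.FriedlanderIwaniecPrimes

/-! ### The position of a prime factor in the decreasing enumeration `p₁ > p₂ > ⋯` -/

/-- The index of `p` in the decreasing enumeration `ℓ = p₁ p₂ ⋯`, `p₁ > p₂ > ⋯` of the prime
factors of `ℓ` (§24: "For every squarefree number, say `ℓ = p₁ p₂ …`, with `p₁ > p₂ > …`"):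
`primeIdx ℓ p = #{q ∣ ℓ prime : q > p} + 1`, so that `primeIdx ℓ pⱼ = j`.
[cite: FriedlanderIwaniecAnnals1998, (24.1)] -/
def primeIdx (ℓ p : ℕ) : ℕ := #(ℓ.primeFactors.filter (p < ·)) + 1

/-- Unfolding `primeIdx`. [cite: FriedlanderIwaniecAnnals1998, (24.1)] -/
theorem primeIdx_def (ℓ p : ℕ) : primeIdx ℓ p = #(ℓ.primeFactors.filter (p < ·)) + 1 := rfl

/-- `1 ≤ primeIdx ℓ p`. [cite: FriedlanderIwaniecAnnals1998, (24.1)] -/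
theorem one_le_primeIdx (ℓ p : ℕ) : 1 ≤ primeIdx ℓ p := Nat.le_add_left 1 _

/-- `primeIdx ℓ p ≤ ω(ℓ)` for a prime factor `p` of `ℓ`. [cite: FriedlanderIwaniecAnnals1998, (24.1)] -/
theorem primeIdx_le_card {ℓ p : ℕ} (hp : p ∈ ℓ.primeFactors) : primeIdx ℓ p ≤ #ℓ.primeFactors := by
  rw [primeIdx_def]
  have : ℓ.primeFactors.filter (p < ·) ⊆ ℓ.primeFactors.erase p := by
    intro q hq
    rw [mem_filter] at hq
    exact mem_erase.mpr ⟨(_root_.ne_of_lt hq.2).symm, hq.1⟩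
  have h := card_le_card this
  rw [card_erase_of_mem hp] at h
  have := card_pos.mpr ⟨p, hp⟩
  omega

/-- Larger prime factors have smaller index: for `p < q` both dividing `ℓ`,
`primeIdx ℓ q < primeIdx ℓ p`. [cite: FriedlanderIwaniecAnnals1998, (24.1)] -/
theorem primeIdx_lt_of_lt {ℓ p q : ℕ} (hq : q ∈ ℓ.primeFactors) (hpq : p < q) :
    primeIdx ℓ q < primeIdx ℓ p := by
  rw [primeIdx_def, primeIdx_def, Nat.add_lt_add_iff_right]
  refine card_lt_card ⟨fun x hx => ?_, fun h => ?_⟩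
  · rw [mem_filter] at hx ⊢; exact ⟨hx.1, hpq.trans hx.2⟩
  · have := h (mem_filter.mpr ⟨hq, hpq⟩)
    rw [mem_filter] at this
    exact lt_irrefl _ this.2

/-- `primeIdx ℓ` is injective on the prime factors of `ℓ`. [cite: FriedlanderIwaniecAnnals1998, (24.1)] -/
theorem primeIdx_injOn (ℓ : ℕ) : Set.InjOn (primeIdx ℓ) ℓ.primeFactors := by
  intro p hp q hq h
  rcases lt_trichotomy p q with hlt | heq | hgt
  · exact absurd h (_root_.ne_of_gt (primeIdx_lt_of_lt hq hlt))
  · exact heq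
  · exact absurd h (_root_.ne_of_lt (primeIdx_lt_of_lt hp hgt))

/-- The indices are exactly `1, …, ω(ℓ)`. [cite: FriedlanderIwaniecAnnals1998, (24.1)] -/
theorem image_primeIdx (ℓ : ℕ) : ℓ.primeFactors.image (primeIdx ℓ) = Icc 1 #ℓ.primeFactors := by
  apply eq_of_subset_of_card_le
  · intro j hj
    obtain ⟨p, hp, rfl⟩ := mem_image.mp hj
    exact mem_Icc.mpr ⟨one_le_primeIdx ℓ p, primeIdx_le_card hp⟩
  · rw [Nat.card_Icc, card_image_of_injOn (primeIdx_injOn ℓ)]; omega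

/-- Every index `1 ≤ j ≤ ω(ℓ)` is the index of a unique prime factor `pⱼ`.
[cite: FriedlanderIwaniecAnnals1998, (24.1)] -/
theorem exists_primeIdx_eq {ℓ j : ℕ} (hj : 1 ≤ j) (hj' : j ≤ #ℓ.primeFactors) :
    ∃ p ∈ ℓ.primeFactors, primeIdx ℓ p = j := by
  have : j ∈ ℓ.primeFactors.image (primeIdx ℓ) := by rw [image_primeIdx]; exact mem_Icc.mpr ⟨hj, hj'⟩
  simpa using mem_image.mp this

/-- Order and index: for prime factors `p, q` of `ℓ`, `p < q ↔ primeIdx ℓ q < primeIdx ℓ p`.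
[cite: FriedlanderIwaniecAnnals1998, (24.1)] -/
theorem lt_iff_primeIdx_lt {ℓ p q : ℕ} (hp : p ∈ ℓ.primeFactors) (hq : q ∈ ℓ.primeFactors) :
    p < q ↔ primeIdx ℓ q < primeIdx ℓ p := by
  constructor
  · exact primeIdx_lt_of_lt hq
  · intro h
    rcases lt_trichotomy p q with hlt | rfl | hgt
    · exact hlt
    · exact absurd h (lt_irrefl _)
    · exact absurd (primeIdx_lt_of_lt hp hgt) (not_lt.mpr h.le)

/-! ### The three index classes and the factorisation `ℓ = 𝔡 m n` (24.2)–(24.7) -/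

section

variable (r : ℕ)

/-- Indices of the separation divisor `𝔡 = p₁ ⋯ p_r p_{2r} p_{3r} ⋯` (24.2): `j ≤ r` or `r ∣ j`.
[cite: FriedlanderIwaniecAnnals1998, (24.2)] -/
def IsSepIdx (j : ℕ) : Prop := j ≤ r ∨ r ∣ j

/-- Indices of `m = (p_{r+1} ⋯ p_{2r-1})(p_{3r+1} ⋯ p_{4r-1}) ⋯` (24.4): `j > r`, `r ∤ j`, in an
odd block `⌊(j-1)/r⌋`. [cite: FriedlanderIwaniecAnnals1998, (24.4)] -/
def IsPlusIdx (j : ℕ) : Prop := r < j ∧ ¬ r ∣ j ∧ Odd ((j - 1) / r)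

/-- Indices of `n = (p_{2r+1} ⋯ p_{3r-1})(p_{4r+1} ⋯ p_{5r-1}) ⋯` (24.5): `j > r`, `r ∤ j`, in an
even block `⌊(j-1)/r⌋`. [cite: FriedlanderIwaniecAnnals1998, (24.5)] -/
def IsMinusIdx (j : ℕ) : Prop := r < j ∧ ¬ r ∣ j ∧ Even ((j - 1) / r)

/-- `IsSepIdx` is decidable. [folklore] -/
instance (j : ℕ) : Decidable (IsSepIdx r j) := inferInstanceAs (Decidable (_ ∨ _))

/-- `IsPlusIdx` is decidable. [folklore] -/
instance (j : ℕ) : Decidable (IsPlusIdx r j) := inferInstanceAs (Decidable (_ ∧ _))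

/-- `IsMinusIdx` is decidable. [folklore] -/
instance (j : ℕ) : Decidable (IsMinusIdx r j) := inferInstanceAs (Decidable (_ ∧ _))

/-- The three index classes partition the positive integers (case analysis).
[cite: FriedlanderIwaniecAnnals1998, (24.7)] -/
theorem isSepIdx_or (j : ℕ) : IsSepIdx r j ∨ IsPlusIdx r j ∨ IsMinusIdx r j := by
  by_cases h1 : j ≤ r
  · exact Or.inl (Or.inl h1)
  by_cases h2 : r ∣ j
  · exact Or.inl (Or.inr h2)
  rcases Nat.even_or_odd ((j - 1) / r) with h | h
  · exact Or.inr (Or.inr ⟨not_le.mp h1, h2, h⟩)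
  · exact Or.inr (Or.inl ⟨not_le.mp h1, h2, h⟩)

/-- `IsSepIdx` and `IsPlusIdx` are disjoint. [cite: FriedlanderIwaniecAnnals1998, (24.7)] -/
theorem not_isPlusIdx_of_isSepIdx {j : ℕ} (h : IsSepIdx r j) : ¬ IsPlusIdx r j := by
  rintro ⟨h1, h2, -⟩
  rcases h with h | h
  · exact absurd h1 (not_lt.mpr h)
  · exact h2 h

/-- `IsSepIdx` and `IsMinusIdx` are disjoint. [cite: FriedlanderIwaniecAnnals1998, (24.7)] -/
theorem not_isMinusIdx_of_isSepIdx {j : ℕ} (h : IsSepIdx r j) : ¬ IsMinusIdx r j := by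
  rintro ⟨h1, h2, -⟩
  rcases h with h | h
  · exact absurd h1 (not_lt.mpr h)
  · exact h2 h

/-- `IsPlusIdx` and `IsMinusIdx` are disjoint. [cite: FriedlanderIwaniecAnnals1998, (24.7)] -/
theorem not_isMinusIdx_of_isPlusIdx {j : ℕ} (h : IsPlusIdx r j) : ¬ IsMinusIdx r j := by
  rintro ⟨-, -, h3⟩
  exact (Nat.not_even_iff_odd.mpr h.2.2) h3

/-- **The separation divisor** `𝔡(ℓ) = p₁ ⋯ p_r · p_{2r} p_{3r} ⋯` of (24.2) (the product of the
prime factors whose index is `≤ r` or divisible by `r`; "the product of primes terminates when it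
runs out of primes of `ℓ`"). [cite: FriedlanderIwaniecAnnals1998, (24.2)] -/
def sepDivisor (ℓ : ℕ) : ℕ := ∏ p ∈ ℓ.primeFactors.filter (fun p => IsSepIdx r (primeIdx ℓ p)), p

/-- **`m = m(ℓ)`** of (24.4). [cite: FriedlanderIwaniecAnnals1998, (24.4)] -/
def plusPart (ℓ : ℕ) : ℕ := ∏ p ∈ ℓ.primeFactors.filter (fun p => IsPlusIdx r (primeIdx ℓ p)), p

/-- **`n = n(ℓ)`** of (24.5). [cite: FriedlanderIwaniecAnnals1998, (24.5)] -/
def minusPart (ℓ : ℕ) : ℕ := ∏ p ∈ ℓ.primeFactors.filter (fun p => IsMinusIdx r (primeIdx ℓ p)), p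

/-- **(24.7)** `ℓ = 𝔡 m n` for squarefree `ℓ`. [cite: FriedlanderIwaniecAnnals1998, (24.7)] -/
theorem sepDivisor_mul_plusPart_mul_minusPart {ℓ : ℕ} (hℓ : Squarefree ℓ) :
    sepDivisor r ℓ * plusPart r ℓ * minusPart r ℓ = ℓ := by
  rw [sepDivisor, plusPart, minusPart]
  have hdisj1 : Disjoint (ℓ.primeFactors.filter fun p => IsSepIdx r (primeIdx ℓ p))
      (ℓ.primeFactors.filter fun p => IsPlusIdx r (primeIdx ℓ p)) :=
    disjoint_filter.mpr fun p _ h => not_isPlusIdx_of_isSepIdx r h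
  rw [← prod_union hdisj1]
  have hdisj2 : Disjoint ((ℓ.primeFactors.filter fun p => IsSepIdx r (primeIdx ℓ p)) ∪
      (ℓ.primeFactors.filter fun p => IsPlusIdx r (primeIdx ℓ p)))
      (ℓ.primeFactors.filter fun p => IsMinusIdx r (primeIdx ℓ p)) := by
    rw [disjoint_union_left]
    exact ⟨disjoint_filter.mpr fun p _ h => not_isMinusIdx_of_isSepIdx r h,
      disjoint_filter.mpr fun p _ h => not_isMinusIdx_of_isPlusIdx r h⟩
  rw [← prod_union hdisj2]
  have hunion : (ℓ.primeFactors.filter fun p => IsSepIdx r (primeIdx ℓ p)) ∪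
      (ℓ.primeFactors.filter fun p => IsPlusIdx r (primeIdx ℓ p)) ∪
      (ℓ.primeFactors.filter fun p => IsMinusIdx r (primeIdx ℓ p)) = ℓ.primeFactors := by
    ext p
    simp only [mem_union, mem_filter]
    constructor
    · rintro ((⟨h, -⟩ | ⟨h, -⟩) | ⟨h, -⟩) <;> exact h
    · intro h
      rcases isSepIdx_or r (primeIdx ℓ p) with h' | h' | h'
      · exact Or.inl (Or.inl ⟨h, h'⟩)
      · exact Or.inl (Or.inr ⟨h, h'⟩)
      · exact Or.inr ⟨h, h'⟩
  rw [hunion, Nat.prod_primeFactors_of_squarefree hℓ]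

/-! ### The inverse enumeration `j ↦ pⱼ` -/

/-- `pⱼ`: the prime factor of `ℓ` with index `j` (and `0` if there is none).
[cite: FriedlanderIwaniecAnnals1998, (24.1)] -/
def nthPrimeDesc (ℓ j : ℕ) : ℕ := (ℓ.primeFactors.filter fun p => primeIdx ℓ p = j).sup id

/-- For `1 ≤ j ≤ ω(ℓ)`, `pⱼ` is a prime factor of `ℓ` with index `j`.
[cite: FriedlanderIwaniecAnnals1998, (24.1)] -/
theorem nthPrimeDesc_spec {ℓ j : ℕ} (hj : 1 ≤ j) (hj' : j ≤ #ℓ.primeFactors) :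
    nthPrimeDesc ℓ j ∈ ℓ.primeFactors ∧ primeIdx ℓ (nthPrimeDesc ℓ j) = j := by
  obtain ⟨p, hp, hpj⟩ := exists_primeIdx_eq hj hj'
  have hset : (ℓ.primeFactors.filter fun q => primeIdx ℓ q = j) = {p} := by
    ext q
    simp only [mem_filter, mem_singleton]
    constructor
    · rintro ⟨hq, hqj⟩; exact primeIdx_injOn ℓ hq hp (hqj.trans hpj.symm)
    · rintro rfl; exact ⟨hp, hpj⟩
  have : nthPrimeDesc ℓ j = p := by rw [nthPrimeDesc, hset, sup_singleton, id]
  rw [this]; exact ⟨hp, hpj⟩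

/-! ### (24.6) `n ≤ m ≤ 𝔡 n` and (24.8) `m, n ≤ √ℓ` -/

/-- Block arithmetic: shifting an index down by `r` lowers the block `⌊(j-1)/r⌋` by one.
[cite: FriedlanderIwaniecAnnals1998, (24.4)–(24.6)] -/
theorem block_sub {r j : ℕ} (hj : r < j) : (j - r - 1) / r = (j - 1) / r - 1 := by
  rw [show j - r - 1 = (j - 1) - r * 1 by omega, Nat.sub_mul_div]

/-- The shift `j ↦ j - r` maps indices of `n` to indices of `m`. [cite: FriedlanderIwaniecAnnals1998, (24.6)] -/
theorem isPlusIdx_sub_of_isMinusIdx {r j : ℕ} (hr : 2 ≤ r) (h : IsMinusIdx r j) : IsPlusIdx r (j - r) := by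
  obtain ⟨h1, h2, h3⟩ := h
  have hr0 : 0 < r := by omega
  -- the block of `j` is even and `≥ 1`, hence `≥ 2`, so `j > 2r`
  have hb1 : 1 ≤ (j - 1) / r := (Nat.le_div_iff_mul_le hr0).mpr (by omega)
  have hb2 : 2 ≤ (j - 1) / r := by
    rcases h3 with ⟨k, hk⟩; omega
  have hj2 : 2 * r < j := by
    have := (Nat.le_div_iff_mul_le hr0).mp hb2; omega
  refine ⟨by omega, fun hd => h2 ?_, ?_⟩
  · have := Nat.dvd_add hd (dvd_refl r); rwa [Nat.sub_add_cancel (by omega)] at this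
  · rw [block_sub h1]
    exact (Nat.odd_sub' hb1).mpr (iff_of_true odd_one h3)

/-- The shift `j ↦ j - r` maps indices of `m` to indices of `𝔡` or of `n`.
[cite: FriedlanderIwaniecAnnals1998, (24.6)] -/
theorem isSepIdx_or_isMinusIdx_sub_of_isPlusIdx {r j : ℕ} (hr : 2 ≤ r) (h : IsPlusIdx r j) :
    IsSepIdx r (j - r) ∨ IsMinusIdx r (j - r) := by
  obtain ⟨h1, h2, h3⟩ := h
  have hr0 : 0 < r := by omega
  by_cases hj : j < 2 * r
  · exact Or.inl (Or.inl (by omega))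
  · right
    have hj2 : 2 * r < j := by
      rcases Nat.lt_or_ge (2 * r) j with h | h
      · exact h
      · exfalso; have : j = 2 * r := by omega
        exact h2 ⟨2, by omega⟩
    have hb1 : 1 ≤ (j - 1) / r := (Nat.le_div_iff_mul_le hr0).mpr (by omega)
    refine ⟨by omega, fun hd => h2 ?_, ?_⟩
    · have := Nat.dvd_add hd (dvd_refl r); rwa [Nat.sub_add_cancel (by omega)] at this
    · rw [block_sub h1]
      exact (Nat.even_sub' hb1).mpr (iff_of_true h3 odd_one)

/-- The shift `p ↦ p'` with `primeIdx ℓ p' = primeIdx ℓ p - r` (the prime `r` places earlier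
in the decreasing enumeration). [cite: FriedlanderIwaniecAnnals1998, (24.6)] -/
def shiftPrime (r ℓ p : ℕ) : ℕ := nthPrimeDesc ℓ (primeIdx ℓ p - r)

/-- The shifted prime is a prime factor `r` places earlier, hence larger, for indices `> r`.
[cite: FriedlanderIwaniecAnnals1998, (24.6)] -/
theorem shiftPrime_spec {r ℓ p : ℕ} (hr0 : 0 < r) (hp : p ∈ ℓ.primeFactors) (hr : r < primeIdx ℓ p) :
    shiftPrime r ℓ p ∈ ℓ.primeFactors ∧ primeIdx ℓ (shiftPrime r ℓ p) = primeIdx ℓ p - r ∧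
      p < shiftPrime r ℓ p := by
  have h := nthPrimeDesc_spec (ℓ := ℓ) (j := primeIdx ℓ p - r) (by omega)
    ((Nat.sub_le _ _).trans (primeIdx_le_card hp))
  refine ⟨h.1, h.2, ?_⟩
  show p < nthPrimeDesc ℓ (primeIdx ℓ p - r)
  rw [lt_iff_primeIdx_lt hp h.1, h.2]
  have := one_le_primeIdx ℓ p
  omega

/-- `shiftPrime` is injective on the prime factors of index `> r`.
[cite: FriedlanderIwaniecAnnals1998, (24.6)] -/
theorem shiftPrime_injOn (r ℓ : ℕ) :
    Set.InjOn (shiftPrime r ℓ) (ℓ.primeFactors.filter fun p => r < primeIdx ℓ p) := by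
  intro p hp q hq h
  rw [mem_coe, mem_filter] at hp hq
  rcases Nat.eq_zero_or_pos r with hr0 | hr0
  · subst hr0
    have e : ∀ x, shiftPrime 0 ℓ x = nthPrimeDesc ℓ (primeIdx ℓ x) := fun x => rfl
    have hp' := nthPrimeDesc_spec (one_le_primeIdx ℓ p) (primeIdx_le_card hp.1)
    have hq' := nthPrimeDesc_spec (one_le_primeIdx ℓ q) (primeIdx_le_card hq.1)
    rw [e, e] at h
    exact primeIdx_injOn ℓ hp.1 hq.1 (by rw [← hp'.2, ← hq'.2, h])
  have hp' := shiftPrime_spec hr0 hp.1 hp.2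
  have hq' := shiftPrime_spec hr0 hq.1 hq.2
  have : primeIdx ℓ p - r = primeIdx ℓ q - r := by rw [← hp'.2.1, ← hq'.2.1, h]
  exact primeIdx_injOn ℓ hp.1 hq.1 (by omega)

/-- A product of distinct primes over a subset divides the product over the superset, hence is
bounded by it. [folklore] -/
theorem prod_le_prod_of_subset_primeFactors {ℓ : ℕ} {s t : Finset ℕ} (hst : s ⊆ t)
    (ht : t ⊆ ℓ.primeFactors) : ∏ p ∈ s, p ≤ ∏ p ∈ t, p :=
  Nat.le_of_dvd (prod_pos fun _ hp => (Nat.prime_of_mem_primeFactors (ht hp)).pos)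
    (prod_dvd_prod_of_subset _ _ _ hst)


/-- **(24.6), first half**: `n ≤ m` (shift every prime of `n` up by `r` places: it lands on a larger
prime of `m`, injectively). [cite: FriedlanderIwaniecAnnals1998, (24.6)] -/
theorem minusPart_le_plusPart {ℓ : ℕ} (hr : 2 ≤ r) : minusPart r ℓ ≤ plusPart r ℓ := by
  rw [minusPart, plusPart]
  set Pn := ℓ.primeFactors.filter fun p => IsMinusIdx r (primeIdx ℓ p)
  set Pm := ℓ.primeFactors.filter fun p => IsPlusIdx r (primeIdx ℓ p)
  have hmem : ∀ p ∈ Pn, p ∈ ℓ.primeFactors ∧ r < primeIdx ℓ p := fun p hp => by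
    rw [mem_filter] at hp; exact ⟨hp.1, hp.2.1⟩
  have h1 : ∏ p ∈ Pn, p ≤ ∏ p ∈ Pn, shiftPrime r ℓ p :=
    prod_le_prod (fun p _ => Nat.zero_le _) fun p hp =>
      (shiftPrime_spec (by omega) (hmem p hp).1 (hmem p hp).2).2.2.le
  have hinj : Set.InjOn (shiftPrime r ℓ) Pn := fun p hp q hq h =>
    shiftPrime_injOn r ℓ (mem_filter.mpr (hmem p hp)) (mem_filter.mpr (hmem q hq)) h
  have h2 : ∏ p ∈ Pn, shiftPrime r ℓ p = ∏ q ∈ Pn.image (shiftPrime r ℓ), q :=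
    (prod_image (f := fun q : ℕ => q) hinj).symm
  have hsub : Pn.image (shiftPrime r ℓ) ⊆ Pm := by
    intro q hq
    obtain ⟨p, hp, rfl⟩ := mem_image.mp hq
    have hp' := mem_filter.mp hp
    have hs := shiftPrime_spec (by omega) hp'.1 hp'.2.1
    exact mem_filter.mpr ⟨hs.1, hs.2.1 ▸ isPlusIdx_sub_of_isMinusIdx hr hp'.2⟩
  calc ∏ p ∈ Pn, p ≤ ∏ p ∈ Pn, shiftPrime r ℓ p := h1
    _ = ∏ q ∈ Pn.image (shiftPrime r ℓ), q := h2
    _ ≤ ∏ q ∈ Pm, q := prod_le_prod_of_subset_primeFactors hsub (filter_subset _ _)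

/-- **(24.6), second half**: `m ≤ 𝔡 n` (shift every prime of `m` up by `r` places: it lands on a
larger prime of `𝔡` (first block) or of `n`, injectively). [cite: FriedlanderIwaniecAnnals1998, (24.6)] -/
theorem plusPart_le_sepDivisor_mul_minusPart {ℓ : ℕ} (hr : 2 ≤ r) :
    plusPart r ℓ ≤ sepDivisor r ℓ * minusPart r ℓ := by
  rw [minusPart, plusPart, sepDivisor]
  set Pn := ℓ.primeFactors.filter fun p => IsMinusIdx r (primeIdx ℓ p)
  set Pm := ℓ.primeFactors.filter fun p => IsPlusIdx r (primeIdx ℓ p)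
  set Pd := ℓ.primeFactors.filter fun p => IsSepIdx r (primeIdx ℓ p)
  have hmem : ∀ p ∈ Pm, p ∈ ℓ.primeFactors ∧ r < primeIdx ℓ p := fun p hp => by
    rw [mem_filter] at hp; exact ⟨hp.1, hp.2.1⟩
  have h1 : ∏ p ∈ Pm, p ≤ ∏ p ∈ Pm, shiftPrime r ℓ p :=
    prod_le_prod (fun p _ => Nat.zero_le _) fun p hp =>
      (shiftPrime_spec (by omega) (hmem p hp).1 (hmem p hp).2).2.2.le
  have hinj : Set.InjOn (shiftPrime r ℓ) Pm := fun p hp q hq h =>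
    shiftPrime_injOn r ℓ (mem_filter.mpr (hmem p hp)) (mem_filter.mpr (hmem q hq)) h
  have h2 : ∏ p ∈ Pm, shiftPrime r ℓ p = ∏ q ∈ Pm.image (shiftPrime r ℓ), q :=
    (prod_image (f := fun q : ℕ => q) hinj).symm
  have hdisj : Disjoint Pd Pn := disjoint_filter.mpr fun p _ h => not_isMinusIdx_of_isSepIdx r h
  have hsub : Pm.image (shiftPrime r ℓ) ⊆ Pd ∪ Pn := by
    intro q hq
    obtain ⟨p, hp, rfl⟩ := mem_image.mp hq
    have hp' := mem_filter.mp hp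
    have hs := shiftPrime_spec (by omega) hp'.1 hp'.2.1
    rcases isSepIdx_or_isMinusIdx_sub_of_isPlusIdx hr hp'.2 with h | h
    · exact mem_union_left _ (mem_filter.mpr ⟨hs.1, hs.2.1 ▸ h⟩)
    · exact mem_union_right _ (mem_filter.mpr ⟨hs.1, hs.2.1 ▸ h⟩)
  calc ∏ p ∈ Pm, p ≤ ∏ p ∈ Pm, shiftPrime r ℓ p := h1
    _ = ∏ q ∈ Pm.image (shiftPrime r ℓ), q := h2
    _ ≤ ∏ q ∈ Pd ∪ Pn, q := prod_le_prod_of_subset_primeFactors hsub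
        (union_subset (filter_subset _ _) (filter_subset _ _))
    _ = (∏ q ∈ Pd, q) * ∏ q ∈ Pn, q := prod_union hdisj

/-- `1 ≤ 𝔡(ℓ)`. [cite: FriedlanderIwaniecAnnals1998, (24.2)] -/
theorem one_le_sepDivisor (ℓ : ℕ) : 1 ≤ sepDivisor r ℓ :=
  prod_pos fun _ hp => (Nat.prime_of_mem_primeFactors (mem_filter.mp hp).1).pos

/-- **(24.8)**: `m² ≤ ℓ` for squarefree `ℓ`. [cite: FriedlanderIwaniecAnnals1998, (24.8)] -/
theorem plusPart_sq_le {ℓ : ℕ} (hr : 2 ≤ r) (hℓ : Squarefree ℓ) : plusPart r ℓ ^ 2 ≤ ℓ := by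
  have h := plusPart_le_sepDivisor_mul_minusPart r hr (ℓ := ℓ)
  have e := sepDivisor_mul_plusPart_mul_minusPart r hℓ
  calc plusPart r ℓ ^ 2 = plusPart r ℓ * plusPart r ℓ := sq _
    _ ≤ plusPart r ℓ * (sepDivisor r ℓ * minusPart r ℓ) := Nat.mul_le_mul_left _ h
    _ = sepDivisor r ℓ * plusPart r ℓ * minusPart r ℓ := by ring
    _ = ℓ := e

/-- **(24.8)**: `n² ≤ ℓ` for squarefree `ℓ`. [cite: FriedlanderIwaniecAnnals1998, (24.8)] -/
theorem minusPart_sq_le {ℓ : ℕ} (hr : 2 ≤ r) (hℓ : Squarefree ℓ) : minusPart r ℓ ^ 2 ≤ ℓ := by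
  have h := minusPart_le_plusPart r hr (ℓ := ℓ)
  have h1 := one_le_sepDivisor r ℓ
  have e := sepDivisor_mul_plusPart_mul_minusPart r hℓ
  calc minusPart r ℓ ^ 2 = minusPart r ℓ * minusPart r ℓ := sq _
    _ ≤ plusPart r ℓ * minusPart r ℓ := Nat.mul_le_mul_right _ h
    _ ≤ sepDivisor r ℓ * (plusPart r ℓ * minusPart r ℓ) := Nat.le_mul_of_pos_left _ h1
    _ = sepDivisor r ℓ * plusPart r ℓ * minusPart r ℓ := by ring
    _ = ℓ := e

/-! ### (24.3) `𝔡 ≤ ℓ^{1/r} p₁^{r-1}` -/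

/-- The block of `r` indices ending at the index of `p`: `{q : idx p - r < idx q ≤ idx p}`.
[cite: FriedlanderIwaniecAnnals1998, (24.3)] -/
def idxBlock (r ℓ p : ℕ) : Finset ℕ :=
  ℓ.primeFactors.filter fun q => primeIdx ℓ p - r < primeIdx ℓ q ∧ primeIdx ℓ q ≤ primeIdx ℓ p

/-- A block below an index `≥ r` has exactly `r` primes. [cite: FriedlanderIwaniecAnnals1998, (24.3)] -/
theorem card_idxBlock {r ℓ p : ℕ} (hp : p ∈ ℓ.primeFactors) (hr : r ≤ primeIdx ℓ p) :
    #(idxBlock r ℓ p) = r := by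
  have himage : (idxBlock r ℓ p).image (primeIdx ℓ) = Ioc (primeIdx ℓ p - r) (primeIdx ℓ p) := by
    ext j
    simp only [mem_image, mem_Ioc, idxBlock, mem_filter]
    constructor
    · rintro ⟨q, ⟨-, h1, h2⟩, rfl⟩; exact ⟨h1, h2⟩
    · rintro ⟨h1, h2⟩
      obtain ⟨q, hq, hqj⟩ := exists_primeIdx_eq (ℓ := ℓ) (j := j) (by omega) (h2.trans (primeIdx_le_card hp))
      exact ⟨q, ⟨hq, by omega, by omega⟩, hqj⟩
  have hinj : Set.InjOn (primeIdx ℓ) (idxBlock r ℓ p) := fun q hq q' hq' h =>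
    primeIdx_injOn ℓ (mem_filter.mp hq).1 (mem_filter.mp hq').1 h
  rw [← card_image_of_injOn hinj, himage, Nat.card_Ioc]
  omega

/-- `p^r ≤ ∏_{q ∈ block(p)} q`: every prime of the block has index `≤ idx p`, so is `≥ p`.
[cite: FriedlanderIwaniecAnnals1998, (24.3)] -/
theorem pow_le_prod_idxBlock {r ℓ p : ℕ} (hp : p ∈ ℓ.primeFactors) (hr : r ≤ primeIdx ℓ p) :
    p ^ r ≤ ∏ q ∈ idxBlock r ℓ p, q := by
  have h := Finset.pow_card_le_prod (idxBlock r ℓ p) (fun q => q) p (fun q hq => by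
    have hq' := mem_filter.mp hq
    rcases Nat.lt_or_ge q p with hlt | hge
    · exact absurd (primeIdx_lt_of_lt hp hlt) (not_lt.mpr hq'.2.2)
    · exact hge)
  rwa [card_idxBlock hp hr] at h

/-- Blocks below distinct multiples of `r` are disjoint. [cite: FriedlanderIwaniecAnnals1998, (24.3)] -/
theorem disjoint_idxBlock {r ℓ p p' : ℕ} (hp : p ∈ ℓ.primeFactors) (hp' : p' ∈ ℓ.primeFactors)
    (hdp : r ∣ primeIdx ℓ p) (hdp' : r ∣ primeIdx ℓ p') (hne : p ≠ p') :
    Disjoint (idxBlock r ℓ p) (idxBlock r ℓ p') := by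
  have hne' : primeIdx ℓ p ≠ primeIdx ℓ p' := fun h => hne (primeIdx_injOn ℓ hp hp' h)
  -- multiples of `r` that differ, differ by at least `r`
  have key : ∀ a b : ℕ, r ∣ a → r ∣ b → a < b → a + r ≤ b := by
    intro a b ha hb hab
    have := Nat.le_of_dvd (by omega) (Nat.dvd_sub hb ha)
    omega
  rw [idxBlock, idxBlock, disjoint_filter]
  intro q _ h1 h2
  rcases lt_or_gt_of_ne hne' with h | h
  · have := key _ _ hdp hdp' h; omega
  · have := key _ _ hdp' hdp h; omega

/-- **(24.3), the core**: `(p_r p_{2r} p_{3r} ⋯)^r ≤ ℓ` for squarefree `ℓ` (each `p_{kr}^r` is at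
most the product of the `r` primes `p_{(k-1)r+1}, …, p_{kr}`).
[cite: FriedlanderIwaniecAnnals1998, (24.3)] -/
theorem prod_core_pow_le {r ℓ : ℕ} (hℓ : Squarefree ℓ) :
    (∏ p ∈ ℓ.primeFactors.filter (fun p => r ∣ primeIdx ℓ p), p) ^ r ≤ ℓ := by
  set Pc := ℓ.primeFactors.filter (fun p => r ∣ primeIdx ℓ p)
  have hmem : ∀ p ∈ Pc, p ∈ ℓ.primeFactors ∧ r ≤ primeIdx ℓ p := fun p hp => by
    have h := mem_filter.mp hp
    exact ⟨h.1, Nat.le_of_dvd (one_le_primeIdx ℓ p) h.2⟩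
  calc (∏ p ∈ Pc, p) ^ r = ∏ p ∈ Pc, p ^ r := (prod_pow _ _ _).symm
    _ ≤ ∏ p ∈ Pc, ∏ q ∈ idxBlock r ℓ p, q :=
        prod_le_prod (fun p _ => Nat.zero_le _) fun p hp => pow_le_prod_idxBlock (hmem p hp).1 (hmem p hp).2
    _ = ∏ q ∈ Pc.biUnion (idxBlock r ℓ), q := by
        rw [prod_biUnion]
        intro p hp p' hp' hne
        exact disjoint_idxBlock (mem_filter.mp hp).1 (mem_filter.mp hp').1 (mem_filter.mp hp).2
          (mem_filter.mp hp').2 hne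
    _ ≤ ∏ q ∈ ℓ.primeFactors, q := prod_le_prod_of_subset_primeFactors
        (biUnion_subset.mpr fun p _ => filter_subset _ _) subset_rfl
    _ = ℓ := Nat.prod_primeFactors_of_squarefree hℓ

/-- **(24.3)** in the form `𝔡(ℓ)^r ≤ P^{r(r-1)} ℓ` whenever all prime factors of the squarefree `ℓ`
are `≤ P` ("Note that `𝔡 ≤ ℓ^{1/r} p₁^{r-1}`"; the first `r - 1` primes are bounded by `P`, the
primes `p_{kr}` by the core estimate). [cite: FriedlanderIwaniecAnnals1998, (24.3)] -/
theorem sepDivisor_pow_le {r ℓ P : ℕ} (hℓ : Squarefree ℓ) (hP1 : 1 ≤ P)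
    (hP : ∀ p ∈ ℓ.primeFactors, p ≤ P) : sepDivisor r ℓ ^ r ≤ P ^ (r * (r - 1)) * ℓ := by
  -- `𝔡 = (p₁ ⋯ p_{r-1}) · (p_r p_{2r} ⋯)`
  have hunion : (ℓ.primeFactors.filter fun p => IsSepIdx r (primeIdx ℓ p)) =
      (ℓ.primeFactors.filter fun p => primeIdx ℓ p < r) ∪ (ℓ.primeFactors.filter fun p => r ∣ primeIdx ℓ p) := by
    ext p
    rw [mem_union, mem_filter, mem_filter, mem_filter, IsSepIdx]
    constructor
    · rintro ⟨hp, h | h⟩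
      · rcases Nat.lt_or_ge (primeIdx ℓ p) r with h' | h'
        · exact Or.inl ⟨hp, h'⟩
        · exact Or.inr ⟨hp, by rw [le_antisymm h h']⟩
      · exact Or.inr ⟨hp, h⟩
    · rintro (⟨hp, h⟩ | ⟨hp, h⟩)
      · exact ⟨hp, Or.inl h.le⟩
      · exact ⟨hp, Or.inr h⟩
  have hdisj : Disjoint (ℓ.primeFactors.filter fun p => primeIdx ℓ p < r)
      (ℓ.primeFactors.filter fun p => r ∣ primeIdx ℓ p) := by
    rw [disjoint_filter]
    intro p _ h1 h2
    exact absurd (Nat.le_of_dvd (one_le_primeIdx ℓ p) h2) (not_le.mpr h1)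
  have hsplit : sepDivisor r ℓ = (∏ p ∈ ℓ.primeFactors.filter (fun p => primeIdx ℓ p < r), p) *
      ∏ p ∈ ℓ.primeFactors.filter (fun p => r ∣ primeIdx ℓ p), p := by
    rw [sepDivisor, hunion, prod_union hdisj]
  set Ph := ℓ.primeFactors.filter (fun p => primeIdx ℓ p < r) with hPh
  -- the head has at most `r - 1` primes, each `≤ P`
  have hcard : #Ph ≤ r - 1 := by
    have hinj : Set.InjOn (primeIdx ℓ) Ph := fun q hq q' hq' h =>
      primeIdx_injOn ℓ (mem_filter.mp hq).1 (mem_filter.mp hq').1 h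
    rw [← card_image_of_injOn hinj]
    have : Ph.image (primeIdx ℓ) ⊆ Icc 1 (r - 1) := by
      intro j hj
      obtain ⟨q, hq, rfl⟩ := mem_image.mp hj
      exact mem_Icc.mpr ⟨one_le_primeIdx ℓ q, by have := (mem_filter.mp hq).2; omega⟩
    exact (card_le_card this).trans (by rw [Nat.card_Icc]; omega)
  have hhead : ∏ p ∈ Ph, p ≤ P ^ (r - 1) := by
    calc ∏ p ∈ Ph, p ≤ ∏ _p ∈ Ph, P :=
          prod_le_prod (fun p _ => Nat.zero_le _) fun p hp => hP p (mem_filter.mp hp).1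
      _ = P ^ #Ph := prod_const _
      _ ≤ P ^ (r - 1) := Nat.pow_le_pow_right hP1 hcard
  calc sepDivisor r ℓ ^ r = (∏ p ∈ Ph, p) ^ r * (∏ p ∈ ℓ.primeFactors.filter (fun p => r ∣ primeIdx ℓ p), p) ^ r := by
        rw [hsplit, mul_pow]
    _ ≤ (P ^ (r - 1)) ^ r * ℓ := Nat.mul_le_mul (Nat.pow_le_pow_left hhead r) (prod_core_pow_le hℓ)
    _ = P ^ (r * (r - 1)) * ℓ := by rw [← pow_mul, mul_comm (r - 1) r]

end

end Literature.NumberTheory.Sieve.FriedlanderIwaniecPrimes
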